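import Literature.Barriers.NavierStokesRegularity.SingularSetDimensionBound
import Literature.Analysis.FluidPDE.CKNTheoremBViscosity
import Literature.Analysis.FluidPDE.SchefferSingularTimes
import HarnessLib

/-!
# Barrier `SingularSetDimensionBound`: reduction to the two analytic leaves

Sibling proofs file of `Literature/Barriers/NavierStokesRegularity/SingularSetDimensionBound.lean`
(the barrier fact `SingularSetDimensionBound = ckn_partial_regularity ∧ scheffer_singular_times`:
Caffarelli–Kohn–Nirenberg 1982, Theorem B, and Leray 1934, §34 / Scheffer 1977 /
Robinson–Rodrigo–Sadowski 2016, Thm. 8.14). It records how far the discharge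
`SingularSetDimensionBound_holds` has been carried in the tree:

* **CKN side.** `Literature.Analysis.FluidPDE.ckn_partial_regularity_of_epsilon_regularity`
  (`CKNTheoremBViscosity.lean`, with `CKNTheoremB.lean`): Theorem B (`𝒫¹(S) = 0`, every
  viscosity, CKN forces) is **proved** from Proposition 2 (the ε-regularity criterion ns.S12,
  named fact `Literature.Analysis.FluidPDE.ckn_epsilon_regularity`) by the Vitali covering
  argument of Caffarelli–Kohn–Nirenberg 1982, §6 (= Robinson–Rodrigo–Sadowski 2016, Thm. 16.2)
  and the viscosity normalisation of their §1.
* **Leray–Scheffer side.**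
  `Literature.Analysis.FluidPDE.scheffer_singular_times_of_leray_local_regular_H1`
  (`SchefferSingularTimes.lean`): `ℋ^{1/2}(singular times) = 0` is **proved** from Leray's local
  regular solutions issued from `H¹` data (named fact
  `Literature.Analysis.FluidPDE.leray_local_regular_H1`, Leray 1934, §§19–24; Ożański–Pooley
  2018, Thm. 6.30, Cor. 6.16) by Leray's structure theorem and the covering argument of
  Leray 1934, §34 / Robinson–Rodrigo–Sadowski 2016, Thm. 8.14.

Hence `singularSetDimensionBound_of_leaves : ckn_epsilon_regularity → leray_local_regular_H1 →
SingularSetDimensionBound` (this file): the barrier fact is reduced to the two central analytic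
leaves of the local regularity theory — CKN's Proposition 2 and Leray's local `H¹` theory — both
pre-existing named facts of `Literature/Analysis/FluidPDE`, and `SingularSetDimensionBound_holds`
is one application away from their discharges. No new definition or named fact is introduced.

## References

* L. Caffarelli, R. Kohn, L. Nirenberg, Comm. Pure Appl. Math. 35 (1982), 771–831, §1, §6,
  Proposition 2, Theorem B. [CaffarelliKohnNirenberg1982]
* J. Leray, Acta Math. 63 (1934), §§19–24, §§33–34. [Leray1934]
* J. C. Robinson, J. L. Rodrigo, W. Sadowski, *The Three-Dimensional Navier–Stokes Equations*,
  CUP (2016), Thm. 8.14, Thm. 16.2. [RobinsonRodrigoSadowski2016]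
-/

noncomputable section

namespace Literature.Barriers.NavierStokesRegularity

/-- **The barrier fact from the two analytic leaves.** Caffarelli–Kohn–Nirenberg's
Proposition 2 (ns.S12, `ckn_epsilon_regularity`) and Leray's local regular `H¹` solutions
(`leray_local_regular_H1`) imply `SingularSetDimensionBound`: the first gives Theorem B for every
viscosity (`ckn_partial_regularity_of_epsilon_regularity`; CKN 1982, §6 and §1), the second gives
Scheffer's theorem on the singular times (`scheffer_singular_times_of_leray_local_regular_H1`;
Leray 1934, §34; Robinson–Rodrigo–Sadowski 2016, Thm. 8.14), and the barrier is their
conjunction (`singularSetDimensionBound_of`).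
[cite: CaffarelliKohnNirenberg1982, Theorem B and Proposition 2] -/
theorem singularSetDimensionBound_of_leaves
    (h₁ : Literature.Analysis.FluidPDE.ckn_epsilon_regularity)
    (h₂ : Literature.Analysis.FluidPDE.leray_local_regular_H1) : SingularSetDimensionBound :=
  singularSetDimensionBound_of
    (Literature.Analysis.FluidPDE.ckn_partial_regularity_of_epsilon_regularity h₁)
    (Literature.Analysis.FluidPDE.scheffer_singular_times_of_leray_local_regular_H1 h₂)

end Literature.Barriers.NavierStokesRegularity
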